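/-
Copyright (c) 2026 the pub-hodgecm-mathlib formalisation cell (harness21).  Prover seat hodgecm-mathlib-A-p16 (g29), architect of road «S3-tree»
(rulings A-57 (a) S-c, A-66 «SPAN-0»), 2026-09-01.
-/
import Literature.NumberTheory.Rogawski1990.UnitaryVertexStabilizerCoverCM        -- ★∕filed A-p16 (g29) S-c FILE A: `exists_vertexStabilizer`, the cover
import Literature.NumberTheory.Rogawski1990.LocalTransferGlueCM                   -- ★ `exists_pieces_classOrbitalIntegral_eq_sum_local`, `finite_support_delta_mul_classOrbitalIntegral_of_isLocSmooth`
import Literature.NumberTheory.Automorphic.OrbitalIntegralSupportLocalisation       -- ★ `isLocSmooth_indicator_of_isClopen`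
import Literature.Topology.LocallyConstantConjugationAverage                        -- ★ A-p16 (g29) S-b: `exists_conj_average_of_hasCompactSupport`
import Literature.LinearAlgebra.Matrix.RegularSemisimpleConjClassClosed             -- ★ `continuous_charpoly_coeff`
import HarnessLib

/-!
# «SPAN»: near the identity, the Δ-weighted orbital sums of any `φ ∈ C_c^∞(U(H′)(L⁺_v))` are those of finitely many `Ad`-invariant pieces supported in
# VERTEX STABILISERS of the `U(H′)_w` lattice tree (Rogawski 1990 §4.9 ∕ Lemma 4.9.3; Langlands–Shelstad descent §2.1)

Topic `NumberTheory/Rogawski1990`; namespace `Literature.NumberTheory.Rogawski1990`.  THEOREMS ONLY (no definition, no instance, no notation, no named fact, no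
`sorry`); kernel lane.  Cell `pub/hodgecm-mathlib` (D-0151), crux H413 = `stmt-HodgeConjecture-24833`, road «S3-tree» (LEAD F0P3a-plan (g11) WORD T10-2), END CONTRACT
(F0P3a-p03 (g14)) stub **«SPAN»**, architect rulings A-57 (a) (brick S-c «ASSEMBLY», FILE B) and A-66 («SPAN-0»).  GENERIC IN THE VERTEX CLASS `P` (a predicate on frames
`g ∈ GL₃(L_w)`): given the COVER HYPOTHESIS «every `δ` whose characteristic polynomial is residually `(X−1)³` stabilises `latt g` for some `g` with `P g`», every test
function has pieces supported in stabilisers of `P`-lattices.  With `P := (IsVertex … ∘ latt)` the cover is ★ FILE A and the conclusion is the two-type «SPAN» (head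
`span_isVertex`, hypothesis-free); with `P :=` self-dual the cover is FILE A + S-a3 («residually unipotent ⇒ a self-dual neighbour is fixed») and the conclusion is «SPAN-0».
HONEST LABEL: HC_CM is proved only modulo the printed citations until rung 0 closes; this file pays no letter by itself (it discharges the stub «SPAN» of the S3-id END).

THE MATHEMATICS.  `G = U(H′)(L⁺_v)`, `v` non-split (`w` the place above), `e : G ≃ₜ* U_w ≤ GL₃(L_w)`; `ι_v : H_v → U(Φ₃)(L⁺_v)` the endoscopic embedding; `Δ` any local
transfer factor (supported on the norm pairs `γ_H → γ`, which are CONJUGATE IN `GL₃(L ⊗ L⁺_v)` to `ι_v(γ_H)`).  `R(A) :⟺ |coeff_i(charpoly A) − coeff_i(charpoly 1)| < 1` for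
`i < 3` (`A ∈ M₃(L_w)`; `charpoly 1 = (X−1)³`, the characteristic polynomial is monic cubic).  (§1) `W′ := {δ ∈ G | R(e δ)}` is CLOPEN (★ `continuous_charpoly_coeff`; `{|x| < 1}` is clopen) and
conjugation invariant; `V := {γ_H | R(ι_v(γ_H)_w)}` is a neighbourhood of `1 ∈ H_v`.  (§2) If `γ_H ∈ V` and `Δ(γ_H, γ_c) ≠ 0` then `γ_H → γ_c`, so `charpoly γ_c =
charpoly ι_v(γ_H)` and the whole class `c` lies in `W′`.  (§3) Orbital bookkeeping at a regular class (family admissible on the regular classes): `Φ(c, 1_S f) = Φ(c, f)` when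
`c ⊆ S`; finite additivity; `Φ(c, f ∘ Ad k) = Φ(c, f)`; so the finite `Ad(K)`-average (★ `exists_conj_average_of_hasCompactSupport`) has the same orbital integrals.  (§4)
ASSEMBLY: `ψ := 1_{W′}·φ ∈ C_c^∞`; its support is covered by the open stabilisers `K_g` of `P`-lattices (cover hypothesis + ★ FILE A `exists_vertexStabilizer`); ★
`exists_pieces_classOrbitalIntegral_eq_sum_local` cuts `ψ = Σ_j ψ_j`, `tsupport ψ_j ⊆ K_{g_j}`, `Φ(c, ψ) = Σ_j Φ(c, ψ_j)` at regular `c`; average each `ψ_j` over `K_{g_j}`; for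
`γ_H ∈ V` regular and every class `c`: `Δ·Φ(c, φ) = Σ_j Δ·Φ(c, g_j)` (both sides vanish when `Δ = 0`); the class sum commutes with `Σ_j` (finite supports ★).

* §1 `isClopen_setOf_v_lt_one`, `charpoly_units_conj_coe`, `isClopen_setOf_residuallyUnipotent`, `setOf_residuallyUnipotent_endoEmbLocal_mem_nhds_one`.
* §2 `residuallyUnipotent_conj_of_delta_ne_zero`.
* §3 `classOrbitalIntegral_indicator_of_forall_conj_mem`, `classOrbitalIntegral_finset_sum_of_isLocSmooth`, `classOrbitalIntegral_comp_conj`, `classOrbitalIntegral_conjAverage_eq`.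
* §4 **`span_of_cover`** (generic `P`) and **`span_isVertex`** (hypothesis-free: the two-type «SPAN»).

## References
* [Rogawski1990] J. D. Rogawski, *Automorphic Representations of Unitary Groups in Three Variables*, Ann. of Math. Stud. 123 (1990): §4.9 p. 54, Lemma 4.9.3 p. 56; §4.3 (4.3.1).
* [LanglandsShelstad1990Descent] R. P. Langlands, D. Shelstad, *Descent for transfer factors* (1990): §2.1.
* [BernsteinZelevinsky1976] I. N. Bernstein, A. V. Zelevinsky, Russian Math. Surveys 31 (1976): §1.1–§1.3.
* [BruhatTits1972] F. Bruhat, J. Tits, *Groupes réductifs sur un corps local I*, Publ. Math. IHÉS 41 (1972): §10.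
-/

set_option autoImplicit false

noncomputable section

open scoped Valued WithZero Matrix MatrixGroups
open Topology Set Function Filter NumberField IsDedekindDomain Matrix MeasureTheory Polynomial

namespace Literature.NumberTheory.Rogawski1990

open Literature.NumberTheory.Automorphic Literature.NumberTheory.Automorphic.UnitaryGroup Literature.NumberTheory.GaloisRepresentations
open Literature.NumberTheory.Automorphic.UnitaryLatticeTree Literature.NumberTheory.Automorphic.HermitianLattice
open Literature.LinearAlgebra.Matrix Literature.Topology

/-! ## §1 The residually-unipotent locus: clopen, conjugation invariant, a neighbourhood of the identity -/

section Locus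

variable {K : Type*} [Field K] [Valued K ℤᵐ⁰]

/-- `{x | |x| < 1}` is CLOPEN in a `ℤᵐ⁰`-valued field with a uniformiser `ϖ`: it is the preimage of the (clopen) valuation ring under `x ↦ ϖ⁻¹x`. [cite: BernsteinZelevinsky1976, §1.1] -/
theorem isClopen_setOf_v_lt_one {ϖ : K} (hϖ : Valued.v ϖ = WithZero.exp (-1 : ℤ)) : IsClopen {x : K | Valued.v x < 1} := by
  have hϖ0 : ϖ ≠ 0 := fun h => by rw [h, map_zero] at hϖ; exact WithZero.coe_ne_zero hϖ.symm
  have hvϖ : Valued.v ϖ ≠ 0 := (Valuation.ne_zero_iff _).2 hϖ0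
  have hset : {x : K | Valued.v x < 1} = (fun x => ϖ⁻¹ * x) ⁻¹' ((Valued.v : Valuation K ℤᵐ⁰).integer : Set K) := by
    ext x
    simp only [Set.mem_setOf_eq, Set.mem_preimage, SetLike.mem_coe, Valuation.mem_integer_iff, map_mul, map_inv₀]
    rw [v_lt_one_iff, ← hϖ]
    constructor
    · intro h
      calc (Valued.v ϖ)⁻¹ * Valued.v x ≤ (Valued.v ϖ)⁻¹ * Valued.v ϖ := mul_le_mul_right h _
        _ = 1 := inv_mul_cancel₀ hvϖ
    · intro h
      calc Valued.v x = Valued.v ϖ * ((Valued.v ϖ)⁻¹ * Valued.v x) := by rw [← mul_assoc, mul_inv_cancel₀ hvϖ, one_mul]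
        _ ≤ Valued.v ϖ * 1 := mul_le_mul_right h _
        _ = Valued.v ϖ := mul_one _
  rw [hset]
  exact (Valued.isClopen_integer K).preimage (continuous_const.mul continuous_id)

/-- Characteristic polynomials are conjugation invariant (units of a matrix ring). [cite: Rogawski1990, §3.1 p. 19] -/
theorem charpoly_units_conj_coe {N : ℕ} {R : Type*} [CommRing R] (y x : GL (Fin N) R) :
    ((y * x * y⁻¹ : GL (Fin N) R) : Matrix (Fin N) (Fin N) R).charpoly = (x : Matrix (Fin N) (Fin N) R).charpoly := by
  rw [Units.val_mul, Units.val_mul, Matrix.coe_units_inv]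
  exact Matrix.charpoly_units_conj y _

/-- `|n| ≤ 1` for every natural number `n` (ultrametric inequality). [cite: BernsteinZelevinsky1976, §1.1] -/
theorem v_natCast_le_one (n : ℕ) : Valued.v (n : K) ≤ 1 := by
  induction n with
  | zero => rw [Nat.cast_zero, map_zero]; exact zero_le
  | succ n ih =>
    rw [Nat.cast_succ]
    exact (Valuation.map_add _ _ _).trans (max_le ih (by rw [map_one]))

/-- The coefficients of `charpoly (1 : M_N(K)) = (X − 1)^N` are integral. [cite: Rogawski1990, §3.1 p. 19] -/
theorem v_charpoly_one_coeff_le_one {N : ℕ} (i : ℕ) : Valued.v ((1 : Matrix (Fin N) (Fin N) K).charpoly.coeff i) ≤ 1 := by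
  have h1 : (1 : Matrix (Fin N) (Fin N) K) = (1 : Matrix (Fin N) (Fin N) 𝒪[K]).map (algebraMap 𝒪[K] K) := by
    rw [Matrix.map_one _ (map_zero _) (map_one _)]
  rw [h1, Matrix.charpoly_map, Polynomial.coeff_map]
  exact ((1 : Matrix (Fin N) (Fin N) 𝒪[K]).charpoly.coeff i).2

/-- **Residually unipotent ⇒ integral characteristic polynomial**: if `|c_i − b_i| < 1` for `i < 3` (`c_i`, `b_i` the coefficients of `charpoly A`, `charpoly 1`,
`A ∈ M₃(K)`), then every coefficient of `charpoly A` is integral (the polynomial is monic cubic). [cite: Rogawski1990, §3.1 p. 19] -/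
theorem v_charpoly_coeff_le_one_of_residuallyUnipotent (A : Matrix (Fin 3) (Fin 3) K)
    (h : ∀ i < 3, Valued.v (A.charpoly.coeff i - (1 : Matrix (Fin 3) (Fin 3) K).charpoly.coeff i) < 1) (i : ℕ) :
    Valued.v (A.charpoly.coeff i) ≤ 1 := by
  rcases lt_or_ge i 3 with hi | hi
  · have hsplit : A.charpoly.coeff i = (A.charpoly.coeff i - (1 : Matrix (Fin 3) (Fin 3) K).charpoly.coeff i) + (1 : Matrix (Fin 3) (Fin 3) K).charpoly.coeff i := by
      ring
    rw [hsplit]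
    exact (Valuation.map_add _ _ _).trans (max_le (h i hi).le (v_charpoly_one_coeff_le_one i))
  · rcases hi.eq_or_lt with h3 | h4
    · have hmon := (Matrix.charpoly_monic A).coeff_natDegree
      rw [Matrix.charpoly_natDegree_eq_dim, Fintype.card_fin] at hmon
      rw [← h3, hmon, map_one]
    · rw [Polynomial.coeff_eq_zero_of_natDegree_lt (by rw [Matrix.charpoly_natDegree_eq_dim, Fintype.card_fin]; exact h4), map_zero]
      exact zero_le

end Locus

section CMLocus

variable (L : Type) [Field L] [NumberField L] [IsCMField L] (H' : Matrix (Fin 3) (Fin 3) L) (v : HeightOneSpectrum (𝓞 ↥(maximalRealSubfield L)))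
  (w : PlacesOver L v) (hw : IsCMField.complexConj L • w.1 = w.1)

/-- **`W′ := {δ | coeff_i(charpoly(e δ)) ≡ coeff_i(charpoly 1) mod 𝔪_w, i < 3}` is CLOPEN in `U(H′)(L⁺_v)`** (`δ ↦ e δ ↦` matrix `↦` coefficient is continuous).
[cite: BernsteinZelevinsky1976, §1.1] [cite: Rogawski1990, §4.9 p. 54] -/
theorem isClopen_setOf_residuallyUnipotent :
    IsClopen {δ : (cmDatum L 3 H').Local v | ∀ i < 3, Valued.v ((((localNonsplitEquiv (IsCMField.complexConj L) H' (IsCMField.complexConj_ne_one L) w hw δ :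
        ↥(unitaryGroupOfForm (galAdicCompletionMap (L := L) (IsCMField.complexConj L) hw) (placeForm H' w.1))) :
          GL (Fin 3) (w.1.adicCompletion L)) : Matrix (Fin 3) (Fin 3) (w.1.adicCompletion L)).charpoly.coeff i -
        (1 : Matrix (Fin 3) (Fin 3) (w.1.adicCompletion L)).charpoly.coeff i) < 1} := by
  obtain ⟨ϖ, hϖ⟩ := exists_uniformizer_adicCompletion L v w
  -- the matrix of `e δ` depends continuously on `δ`
  have hcont : Continuous fun δ : (cmDatum L 3 H').Local v =>
      (((localNonsplitEquiv (IsCMField.complexConj L) H' (IsCMField.complexConj_ne_one L) w hw δ :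
        ↥(unitaryGroupOfForm (galAdicCompletionMap (L := L) (IsCMField.complexConj L) hw) (placeForm H' w.1))) :
          GL (Fin 3) (w.1.adicCompletion L)) : Matrix (Fin 3) (Fin 3) (w.1.adicCompletion L)) :=
    Units.continuous_val.comp (continuous_subtype_val.comp
      (localNonsplitEquiv (IsCMField.complexConj L) H' (IsCMField.complexConj_ne_one L) w hw).continuous)
  have hset : {δ : (cmDatum L 3 H').Local v | ∀ i < 3, Valued.v ((((localNonsplitEquiv (IsCMField.complexConj L) H' (IsCMField.complexConj_ne_one L) w hw δ :
        ↥(unitaryGroupOfForm (galAdicCompletionMap (L := L) (IsCMField.complexConj L) hw) (placeForm H' w.1))) :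
          GL (Fin 3) (w.1.adicCompletion L)) : Matrix (Fin 3) (Fin 3) (w.1.adicCompletion L)).charpoly.coeff i -
        (1 : Matrix (Fin 3) (Fin 3) (w.1.adicCompletion L)).charpoly.coeff i) < 1} =
      ⋂ i ∈ Finset.range 3, (fun δ : (cmDatum L 3 H').Local v =>
        (((localNonsplitEquiv (IsCMField.complexConj L) H' (IsCMField.complexConj_ne_one L) w hw δ :
          ↥(unitaryGroupOfForm (galAdicCompletionMap (L := L) (IsCMField.complexConj L) hw) (placeForm H' w.1))) :
            GL (Fin 3) (w.1.adicCompletion L)) : Matrix (Fin 3) (Fin 3) (w.1.adicCompletion L)).charpoly.coeff i -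
          (1 : Matrix (Fin 3) (Fin 3) (w.1.adicCompletion L)).charpoly.coeff i) ⁻¹' {x | Valued.v x < 1} := by
    ext δ
    simp only [Set.mem_setOf_eq, Set.mem_iInter, Set.mem_preimage, Finset.mem_range]
  rw [hset]
  exact isClopen_biInter_finset fun i _ => (isClopen_setOf_v_lt_one hϖ).preimage
    (((continuous_charpoly_coeff i).comp hcont).sub continuous_const)

omit hw in
/-- **`V := {γ_H | coeff_i(charpoly(ι_v(γ_H)_w)) ≡ coeff_i(charpoly 1) mod 𝔪_w, i < 3}` IS A NEIGHBOURHOOD OF `1 ∈ H_v`** (open by continuity of `ι_v` and of the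
coefficients; contains `1` trivially). [cite: Rogawski1990, §4.9 p. 54] [cite: BernsteinZelevinsky1976, §1.1] -/
theorem setOf_residuallyUnipotent_endoEmbLocal_mem_nhds_one :
    {γH : (cmDatum L 2 (Matrix.of fun i j : Fin 2 => if i.val + j.val + 1 = 2 then (1 : L) else 0)).Local v ×
        (cmDatum L 1 (Matrix.of fun i j : Fin 1 => if i.val + j.val + 1 = 1 then (1 : L) else 0)).Local v |
      ∀ i < 3, Valued.v (((((endoEmbLocal L v γH).val : GL (Fin 3) (LocalRing L v)) : Matrix (Fin 3) (Fin 3) (LocalRing L v)).map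
        (Pi.evalRingHom (fun w' : PlacesOver L v => w'.1.adicCompletion L) w)).charpoly.coeff i - (1 : Matrix (Fin 3) (Fin 3) (w.1.adicCompletion L)).charpoly.coeff i) < 1} ∈
      𝓝 (1 : (cmDatum L 2 (Matrix.of fun i j : Fin 2 => if i.val + j.val + 1 = 2 then (1 : L) else 0)).Local v ×
        (cmDatum L 1 (Matrix.of fun i j : Fin 1 => if i.val + j.val + 1 = 1 then (1 : L) else 0)).Local v) := by
  obtain ⟨ϖ, hϖ⟩ := exists_uniformizer_adicCompletion L v w
  have hcont : Continuous fun γH : (cmDatum L 2 (Matrix.of fun i j : Fin 2 => if i.val + j.val + 1 = 2 then (1 : L) else 0)).Local v ×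
        (cmDatum L 1 (Matrix.of fun i j : Fin 1 => if i.val + j.val + 1 = 1 then (1 : L) else 0)).Local v =>
      ((((endoEmbLocal L v γH).val : GL (Fin 3) (LocalRing L v)) : Matrix (Fin 3) (Fin 3) (LocalRing L v)).map
        (Pi.evalRingHom (fun w' : PlacesOver L v => w'.1.adicCompletion L) w)) := by
    refine Continuous.matrix_map ?_ (continuous_apply w)
    exact Units.continuous_val.comp (continuous_subtype_val.comp (continuous_endoEmbLocal L v))
  refine IsOpen.mem_nhds ?_ ?_
  · have hset : {γH : (cmDatum L 2 (Matrix.of fun i j : Fin 2 => if i.val + j.val + 1 = 2 then (1 : L) else 0)).Local v ×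
          (cmDatum L 1 (Matrix.of fun i j : Fin 1 => if i.val + j.val + 1 = 1 then (1 : L) else 0)).Local v |
        ∀ i < 3, Valued.v (((((endoEmbLocal L v γH).val : GL (Fin 3) (LocalRing L v)) : Matrix (Fin 3) (Fin 3) (LocalRing L v)).map
          (Pi.evalRingHom (fun w' : PlacesOver L v => w'.1.adicCompletion L) w)).charpoly.coeff i - (1 : Matrix (Fin 3) (Fin 3) (w.1.adicCompletion L)).charpoly.coeff i) < 1} =
        ⋂ i ∈ Finset.range 3, (fun γH => (((((endoEmbLocal L v γH).val : GL (Fin 3) (LocalRing L v)) : Matrix (Fin 3) (Fin 3) (LocalRing L v)).map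
          (Pi.evalRingHom (fun w' : PlacesOver L v => w'.1.adicCompletion L) w)).charpoly.coeff i - (1 : Matrix (Fin 3) (Fin 3) (w.1.adicCompletion L)).charpoly.coeff i)) ⁻¹'
            {x | Valued.v x < 1} := by
      ext γH
      simp only [Set.mem_setOf_eq, Set.mem_iInter, Set.mem_preimage, Finset.mem_range]
    rw [hset]
    exact (isClopen_biInter_finset fun i _ => (isClopen_setOf_v_lt_one hϖ).preimage (((continuous_charpoly_coeff i).comp hcont).sub continuous_const)).isOpen
  · intro i _
    rw [map_one]
    have h1 : ((1 : (cmDatum L 3 (Matrix.of fun i j : Fin 3 => if i.val + j.val + 1 = 3 then (1 : L) else 0)).Local v).val :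
        GL (Fin 3) (LocalRing L v)) = 1 := rfl
    rw [h1, Units.val_one, Matrix.map_one _ (map_zero _) (map_one _), sub_self, map_zero]
    exact zero_lt_one

end CMLocus

/-! ## §2 Matched classes of a residually-unipotent `γ_H` lie in `W′` -/

section Matched

variable (L : Type) [Field L] [NumberField L] [IsCMField L] (H' : Matrix (Fin 3) (Fin 3) L) (v : HeightOneSpectrum (𝓞 ↥(maximalRealSubfield L)))
  (w : PlacesOver L v) (hw : IsCMField.complexConj L • w.1 = w.1)

/-- The one-place model reads the `w`-component of the matrix (definitional; ★ `coe_localNonsplitEquiv_apply`). [cite: PlatonovRapinchuk1994, §5.1] -/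
theorem coe_localNonsplitEquiv_cmDatum_apply (g : (cmDatum L 3 H').Local v) :
    (((localNonsplitEquiv (IsCMField.complexConj L) H' (IsCMField.complexConj_ne_one L) w hw g :
        ↥(unitaryGroupOfForm (galAdicCompletionMap (L := L) (IsCMField.complexConj L) hw) (placeForm H' w.1))) :
          GL (Fin 3) (w.1.adicCompletion L)) : Matrix (Fin 3) (Fin 3) (w.1.adicCompletion L)) =
      ((g.val : GL (Fin 3) (LocalRing L v)) : Matrix (Fin 3) (Fin 3) (LocalRing L v)).map
        (Pi.evalRingHom (fun w' : PlacesOver L v => w'.1.adicCompletion L) w) := rfl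

/-- **If `Δ(γ_H, γ_c) ≠ 0` then every `δ ∈ [γ_c]` has `charpoly(e δ) = charpoly(ι_v(γ_H))_w`** (`Δ` is supported on `γ_H → γ_c` = conjugacy of `ι_v(γ_H)` and `γ_c` in
`GL₃(L ⊗ L⁺_v)`; characteristic polynomials are conjugation invariant and `e` reads the `w`-component).  Hence residual unipotence transfers from `γ_H` to the class.
[cite: Rogawski1990, §4.3 p. 43; §14.1 p. 232] -/
theorem charpoly_conj_out_eq_of_delta_ne_zero (T : LocalTransferFactor L H' v)
    (γH : (cmDatum L 2 (Matrix.of fun i j : Fin 2 => if i.val + j.val + 1 = 2 then (1 : L) else 0)).Local v ×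
      (cmDatum L 1 (Matrix.of fun i j : Fin 1 => if i.val + j.val + 1 = 1 then (1 : L) else 0)).Local v)
    (c : ConjClasses ((cmDatum L 3 H').Local v)) (hΔ : T.Δ γH (Quotient.out c) ≠ 0) (y : (cmDatum L 3 H').Local v) :
    (((localNonsplitEquiv (IsCMField.complexConj L) H' (IsCMField.complexConj_ne_one L) w hw (y * Quotient.out c * y⁻¹) :
        ↥(unitaryGroupOfForm (galAdicCompletionMap (L := L) (IsCMField.complexConj L) hw) (placeForm H' w.1))) :
          GL (Fin 3) (w.1.adicCompletion L)) : Matrix (Fin 3) (Fin 3) (w.1.adicCompletion L)).charpoly =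
      ((((endoEmbLocal L v γH).val : GL (Fin 3) (LocalRing L v)) : Matrix (Fin 3) (Fin 3) (LocalRing L v)).map
        (Pi.evalRingHom (fun w' : PlacesOver L v => w'.1.adicCompletion L) w)).charpoly := by
  -- the norm pair, as conjugacy in `GL₃(L ⊗ L⁺_v)`
  have hR : IsLocalNormPair L H' v γH (Quotient.out c) := by
    by_contra hn; exact hΔ (T.eq_zero_of_not_rel _ _ hn)
  have hcp := ((isLocalNormPair_iff L H' v γH (Quotient.out c)).1 hR).charpoly_eq
  -- the one-place model, re-typed on the `cmDatum` carrier so that `map_mul` runs in one rendering of the group law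
  obtain ⟨E, hE⟩ : ∃ E : (cmDatum L 3 H').Local v ≃ₜ* ↥(unitaryGroupOfForm (galAdicCompletionMap (L := L) (IsCMField.complexConj L) hw) (placeForm H' w.1)),
      ∀ g, ((E g : ↥(unitaryGroupOfForm (galAdicCompletionMap (L := L) (IsCMField.complexConj L) hw) (placeForm H' w.1))) : GL (Fin 3) (w.1.adicCompletion L)) =
        ((localNonsplitEquiv (IsCMField.complexConj L) H' (IsCMField.complexConj_ne_one L) w hw g :
          ↥(unitaryGroupOfForm (galAdicCompletionMap (L := L) (IsCMField.complexConj L) hw) (placeForm H' w.1))) : GL (Fin 3) (w.1.adicCompletion L)) :=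
    ⟨localNonsplitEquiv (IsCMField.complexConj L) H' (IsCMField.complexConj_ne_one L) w hw, fun _ => rfl⟩
  rw [← hE, map_mul, map_mul, map_inv, Subgroup.coe_mul, Subgroup.coe_mul, Subgroup.coe_inv, charpoly_units_conj_coe, hE,
    coe_localNonsplitEquiv_cmDatum_apply L H' v w hw, Matrix.charpoly_map, Matrix.charpoly_map, hcp]

/-- **Residual unipotence transfers along the norm pairs**: if `γ_H ∈ V` and `Δ(γ_H, γ_c) ≠ 0` then every conjugate `y γ_c y⁻¹` lies in `W′`.
[cite: Rogawski1990, §4.3 p. 43; §4.9 p. 54] -/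
theorem residuallyUnipotent_conj_of_delta_ne_zero (T : LocalTransferFactor L H' v)
    (γH : (cmDatum L 2 (Matrix.of fun i j : Fin 2 => if i.val + j.val + 1 = 2 then (1 : L) else 0)).Local v ×
      (cmDatum L 1 (Matrix.of fun i j : Fin 1 => if i.val + j.val + 1 = 1 then (1 : L) else 0)).Local v)
    (hγ : ∀ i < 3, Valued.v (((((endoEmbLocal L v γH).val : GL (Fin 3) (LocalRing L v)) : Matrix (Fin 3) (Fin 3) (LocalRing L v)).map
        (Pi.evalRingHom (fun w' : PlacesOver L v => w'.1.adicCompletion L) w)).charpoly.coeff i - (1 : Matrix (Fin 3) (Fin 3) (w.1.adicCompletion L)).charpoly.coeff i) < 1)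
    (c : ConjClasses ((cmDatum L 3 H').Local v)) (hΔ : T.Δ γH (Quotient.out c) ≠ 0) (y : (cmDatum L 3 H').Local v) :
    ∀ i < 3, Valued.v ((((localNonsplitEquiv (IsCMField.complexConj L) H' (IsCMField.complexConj_ne_one L) w hw (y * Quotient.out c * y⁻¹) :
        ↥(unitaryGroupOfForm (galAdicCompletionMap (L := L) (IsCMField.complexConj L) hw) (placeForm H' w.1))) :
          GL (Fin 3) (w.1.adicCompletion L)) : Matrix (Fin 3) (Fin 3) (w.1.adicCompletion L)).charpoly.coeff i -
        (1 : Matrix (Fin 3) (Fin 3) (w.1.adicCompletion L)).charpoly.coeff i) < 1 := by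
  intro i hi
  rw [charpoly_conj_out_eq_of_delta_ne_zero L H' v w hw T γH c hΔ y]
  exact hγ i hi

end Matched

/-! ## §3 Orbital bookkeeping at a regular class -/

section Orbital

variable (L : Type) [Field L] [NumberField L] [IsCMField L] (H' : Matrix (Fin 3) (Fin 3) L) (v : HeightOneSpectrum (𝓞 ↥(maximalRealSubfield L)))
  [iM' : ∀ γ : (cmDatum L 3 H').Local v, MeasurableSpace ((cmDatum L 3 H').Local v ⧸ Subgroup.centralizer ({γ} : Set ((cmDatum L 3 H').Local v)))]
  [iB' : ∀ γ : (cmDatum L 3 H').Local v, BorelSpace ((cmDatum L 3 H').Local v ⧸ Subgroup.centralizer ({γ} : Set ((cmDatum L 3 H').Local v)))]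

omit iB' in
/-- **`Φ(c, 1_S·f) = Φ(c, f)` when the whole class lies in `S`** (the orbital integrands agree pointwise). [cite: Rogawski1990, §4.9 p. 54] -/
theorem classOrbitalIntegral_indicator_of_forall_conj_mem (mG : OrbitalMeasureFamily ((cmDatum L 3 H').Local v)) (c : ConjClasses ((cmDatum L 3 H').Local v))
    {S : Set ((cmDatum L 3 H').Local v)} (hS : ∀ y : (cmDatum L 3 H').Local v, y * Quotient.out c * y⁻¹ ∈ S) (f : (cmDatum L 3 H').Local v → ℂ) :
    classOrbitalIntegral mG (S.indicator f) c = classOrbitalIntegral mG f c := by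
  simp only [classOrbitalIntegral_eq, orbitalIntegral_eq_integral_descConj]
  refine integral_congr_ae (Eventually.of_forall fun y => ?_)
  induction y using QuotientGroup.induction_on with
  | H g =>
    rw [Literature.MeasureTheory.Group.descConj_mk, Literature.MeasureTheory.Group.descConj_mk]
    exact Set.indicator_of_mem (hS g) f

/-- **Finite additivity of `Φ(c, ·)` on `C_c^∞` at a regular class** (family admissible on the regular classes). [cite: Rogawski1990, §4.9 p. 54] -/
theorem classOrbitalIntegral_finset_sum_of_isLocSmooth (hH' : (H'.map (cmConjRingHom L))ᵀ = H') (hdet' : H'.det ≠ 0)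
    {mG : OrbitalMeasureFamily ((cmDatum L 3 H').Local v)} (hmG : mG.IsAdmissibleOn fun γ' => IsRegularElt (γ'.val : GL (Fin 3) (LocalRing L v)))
    (c : ConjClasses ((cmDatum L 3 H').Local v)) (hc : IsRegularElt ((Quotient.out c).val : GL (Fin 3) (LocalRing L v)))
    {ι : Type*} (s : Finset ι) (f : ι → (cmDatum L 3 H').Local v → ℂ) (hf : ∀ i ∈ s, IsLocSmooth (f i)) :
    classOrbitalIntegral mG (fun x => ∑ i ∈ s, f i x) c = ∑ i ∈ s, classOrbitalIntegral mG (f i) c := by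
  classical
  induction s using Finset.induction_on with
  | empty =>
    simp only [Finset.sum_empty]
    rw [classOrbitalIntegral_eq]
    exact orbitalIntegral_zero_fun _ _
  | insert i s hi ih =>
    have hfs : IsLocSmooth (fun x => ∑ j ∈ s, f j x) := by
      have : ∀ t : Finset ι, (∀ j ∈ t, IsLocSmooth (f j)) → IsLocSmooth (fun x => ∑ j ∈ t, f j x) := by
        intro t ht
        induction t using Finset.induction_on with
        | empty => simp only [Finset.sum_empty]; exact isLocSmooth_zero
        | insert j t hj iht =>
          have hsum : (fun x => ∑ k ∈ insert j t, f k x) = f j + fun x => ∑ k ∈ t, f k x := by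
            funext x; simp only [Finset.sum_insert hj, Pi.add_apply]
          rw [hsum]
          exact (ht j (Finset.mem_insert_self j t)).add (iht fun k hk => ht k (Finset.mem_insert_of_mem hk))
      exact this s fun j hj => hf j (Finset.mem_insert_of_mem hj)
    have hsum : (fun x => ∑ j ∈ insert i s, f j x) = f i + fun x => ∑ j ∈ s, f j x := by
      funext x; simp only [Finset.sum_insert hi, Pi.add_apply]
    rw [Finset.sum_insert hi, hsum, UnitaryGroup.classOrbitalIntegral_add_of_isAdmissibleOn L 3 H' v hH' hdet' hmG c hc
      (hf i (Finset.mem_insert_self i s)).1.continuous (hf i (Finset.mem_insert_self i s)).2 hfs.1.continuous hfs.2,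
      ih fun j hj => hf j (Finset.mem_insert_of_mem hj)]

/-- **Conjugation invariance `Φ(c, f ∘ Ad k) = Φ(c, f)` at a regular class** (the admissible member `m_c` is `G`-invariant). [cite: Rogawski1990, §4.9 p. 54] -/
theorem classOrbitalIntegral_comp_conj {mG : OrbitalMeasureFamily ((cmDatum L 3 H').Local v)}
    (hmG : mG.IsAdmissibleOn fun γ' => IsRegularElt (γ'.val : GL (Fin 3) (LocalRing L v)))
    (c : ConjClasses ((cmDatum L 3 H').Local v)) (hc : IsRegularElt ((Quotient.out c).val : GL (Fin 3) (LocalRing L v)))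
    (f : (cmDatum L 3 H').Local v → ℂ) (k : (cmDatum L 3 H').Local v) :
    classOrbitalIntegral mG (fun x => f (k * x * k⁻¹)) c = classOrbitalIntegral mG f c := by
  have hinv : SMulInvariantMeasure ((cmDatum L 3 H').Local v)
      ((cmDatum L 3 H').Local v ⧸ Subgroup.centralizer ({(Quotient.out c : (cmDatum L 3 H').Local v)} : Set ((cmDatum L 3 H').Local v))) (mG c) :=
    hmG.smulInvariantMeasure hc
  have hf : (fun x => f (k * x * k⁻¹)) = f ∘ MulAut.conj k := by funext x; rfl
  rw [classOrbitalIntegral_eq, classOrbitalIntegral_eq, hf]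
  exact @orbitalIntegral_conj_eq _ _ _ _ (Quotient.out c) (iM' (Quotient.out c)) (iB' (Quotient.out c)) (mG c) hinv k f

/-- **The finite `Ad(K)`-average has the same orbital integrals at a regular class**: for `k_i` (`i : Fin n`, `0 < n`),
`Φ(c, x ↦ n⁻¹ Σ_i f (k_i x k_i⁻¹)) = Φ(c, f)`. [cite: Rogawski1990, §4.9 p. 54] [cite: BernsteinZelevinsky1976, §1.2] -/
theorem classOrbitalIntegral_conjAverage_eq (hH' : (H'.map (cmConjRingHom L))ᵀ = H') (hdet' : H'.det ≠ 0)
    {mG : OrbitalMeasureFamily ((cmDatum L 3 H').Local v)} (hmG : mG.IsAdmissibleOn fun γ' => IsRegularElt (γ'.val : GL (Fin 3) (LocalRing L v)))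
    (c : ConjClasses ((cmDatum L 3 H').Local v)) (hc : IsRegularElt ((Quotient.out c).val : GL (Fin 3) (LocalRing L v)))
    {f : (cmDatum L 3 H').Local v → ℂ} (hf : IsLocSmooth f) {n : ℕ} (hn : 0 < n) (k : Fin n → (cmDatum L 3 H').Local v) :
    classOrbitalIntegral mG (fun x => (n : ℂ)⁻¹ * ∑ i, f (k i * x * (k i)⁻¹)) c = classOrbitalIntegral mG f c := by
  have hsmul : (fun x => (n : ℂ)⁻¹ * ∑ i, f (k i * x * (k i)⁻¹)) = (n : ℂ)⁻¹ • fun x => ∑ i, f (k i * x * (k i)⁻¹) := by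
    funext x; simp only [Pi.smul_apply, smul_eq_mul]
  rw [hsmul, classOrbitalIntegral_eq, orbitalIntegral_smul, ← classOrbitalIntegral_eq,
    classOrbitalIntegral_finset_sum_of_isLocSmooth L H' v hH' hdet' hmG c hc Finset.univ (fun i x => f (k i * x * (k i)⁻¹))
      (fun i _ => isLocSmooth_comp_conj hf (k i))]
  simp_rw [classOrbitalIntegral_comp_conj L H' v hmG c hc f]
  rw [Finset.sum_const, Finset.card_univ, Fintype.card_fin, nsmul_eq_mul, smul_eq_mul, ← mul_assoc,
    inv_mul_cancel₀ (Nat.cast_ne_zero.2 hn.ne'), one_mul]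

end Orbital


/-! ## §4 «SPAN»: the assembly -/

section Span

variable (L : Type) [Field L] [NumberField L] [IsCMField L] (H' : Matrix (Fin 3) (Fin 3) L) (v : HeightOneSpectrum (𝓞 ↥(maximalRealSubfield L)))
  (w : PlacesOver L v) (hw : IsCMField.complexConj L • w.1 = w.1)
  [iM' : ∀ γ : (cmDatum L 3 H').Local v, MeasurableSpace ((cmDatum L 3 H').Local v ⧸ Subgroup.centralizer ({γ} : Set ((cmDatum L 3 H').Local v)))]
  [iB' : ∀ γ : (cmDatum L 3 H').Local v, BorelSpace ((cmDatum L 3 H').Local v ⧸ Subgroup.centralizer ({γ} : Set ((cmDatum L 3 H').Local v)))]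

/-- **«SPAN» FROM A VERTEX COVER (generic in the vertex class `P`).**  `H′` `c`-hermitian with `det H′ ≠ 0`, `v` non-split (`w`, `hw`), `Δ` ANY local transfer factor,
`m_G` admissible on the regular classes.  Suppose every `δ ∈ U(H′)(L⁺_v)` whose characteristic polynomial (read at `w`) is residually that of `1` stabilises `latt g` for some
frame `g` with `P g` (`hcov`).  Then every `φ ∈ C_c^∞(U(H′)(L⁺_v))` has finitely many PIECES `g_k ∈ C_c^∞`, supported in compact open stabilisers `K_k` of `P`-lattices and
`Ad(K_k)`-invariant, and a neighbourhood `V` of `1 ∈ H_v` such that `Σᶠ_c Δ(γ_H, γ_c)Φ(c, φ) = Σ_k Σᶠ_c Δ(γ_H, γ_c)Φ(c, g_k)` for every `G`-regular `γ_H ∈ V`.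
[cite: Rogawski1990, §4.9 p. 54, Lemma 4.9.3 p. 56] [cite: LanglandsShelstad1990Descent, §2.1] [cite: BernsteinZelevinsky1976, §1.1–§1.3] -/
theorem span_of_cover (hH' : (H'.map (cmConjRingHom L))ᵀ = H') (hdet' : H'.det ≠ 0)
    {P : GL (Fin 3) (w.1.adicCompletion L) → Prop}
    (hcov : ∀ δ : (cmDatum L 3 H').Local v,
      (∀ i < 3, Valued.v ((((localNonsplitEquiv (IsCMField.complexConj L) H' (IsCMField.complexConj_ne_one L) w hw δ :
        ↥(unitaryGroupOfForm (galAdicCompletionMap (L := L) (IsCMField.complexConj L) hw) (placeForm H' w.1))) :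
          GL (Fin 3) (w.1.adicCompletion L)) : Matrix (Fin 3) (Fin 3) (w.1.adicCompletion L)).charpoly.coeff i -
        (1 : Matrix (Fin 3) (Fin 3) (w.1.adicCompletion L)).charpoly.coeff i) < 1) →
      ∃ g : GL (Fin 3) (w.1.adicCompletion L), P g ∧
        mapGL ((localNonsplitEquiv (IsCMField.complexConj L) H' (IsCMField.complexConj_ne_one L) w hw δ :
            ↥(unitaryGroupOfForm (galAdicCompletionMap (L := L) (IsCMField.complexConj L) hw) (placeForm H' w.1))) :
          GL (Fin 3) (w.1.adicCompletion L)) (latt (g : Matrix (Fin 3) (Fin 3) (w.1.adicCompletion L))) = latt (g : Matrix (Fin 3) (Fin 3) (w.1.adicCompletion L)))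
    (T : LocalTransferFactor L H' v) {mG : OrbitalMeasureFamily ((cmDatum L 3 H').Local v)}
    (hmG : mG.IsAdmissibleOn fun γ' => IsRegularElt (γ'.val : GL (Fin 3) (LocalRing L v)))
    (φ : (cmDatum L 3 H').Local v → ℂ) (hφ : IsLocSmooth φ) :
    ∃ (n : ℕ) (K : Fin n → Subgroup ((cmDatum L 3 H').Local v)) (g : Fin n → (cmDatum L 3 H').Local v → ℂ),
      (∀ k, ∃ gk : GL (Fin 3) (w.1.adicCompletion L), P gk ∧ IsCompact (K k : Set ((cmDatum L 3 H').Local v)) ∧ IsOpen (K k : Set ((cmDatum L 3 H').Local v)) ∧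
        ∀ u : (cmDatum L 3 H').Local v, u ∈ K k ↔
          mapGL ((localNonsplitEquiv (IsCMField.complexConj L) H' (IsCMField.complexConj_ne_one L) w hw u :
              ↥(unitaryGroupOfForm (galAdicCompletionMap (L := L) (IsCMField.complexConj L) hw) (placeForm H' w.1))) :
            GL (Fin 3) (w.1.adicCompletion L)) (latt (gk : Matrix (Fin 3) (Fin 3) (w.1.adicCompletion L))) = latt (gk : Matrix (Fin 3) (Fin 3) (w.1.adicCompletion L))) ∧
      (∀ k, IsLocSmooth (g k)) ∧ (∀ k, tsupport (g k) ⊆ (K k : Set ((cmDatum L 3 H').Local v))) ∧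
      (∀ k, ∀ u ∈ K k, ∀ x, g k (u * x * u⁻¹) = g k x) ∧
      ∃ V ∈ 𝓝 (1 : (cmDatum L 2 (Matrix.of fun i j : Fin 2 => if i.val + j.val + 1 = 2 then (1 : L) else 0)).Local v ×
          (cmDatum L 1 (Matrix.of fun i j : Fin 1 => if i.val + j.val + 1 = 1 then (1 : L) else 0)).Local v),
        ∀ γH ∈ V, IsLocalGRegular L v γH →
          (∑ᶠ c : ConjClasses ((cmDatum L 3 H').Local v), T.Δ γH (Quotient.out c) * classOrbitalIntegral mG φ c) =
            ∑ k, ∑ᶠ c : ConjClasses ((cmDatum L 3 H').Local v), T.Δ γH (Quotient.out c) * classOrbitalIntegral mG (g k) c := by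
  classical
  -- the residually-unipotent locus `W′` and the truncation `ψ := 1_{W′}·φ`
  set W' : Set ((cmDatum L 3 H').Local v) := {δ | ∀ i < 3, Valued.v ((((localNonsplitEquiv (IsCMField.complexConj L) H' (IsCMField.complexConj_ne_one L) w hw δ :
        ↥(unitaryGroupOfForm (galAdicCompletionMap (L := L) (IsCMField.complexConj L) hw) (placeForm H' w.1))) :
          GL (Fin 3) (w.1.adicCompletion L)) : Matrix (Fin 3) (Fin 3) (w.1.adicCompletion L)).charpoly.coeff i -
        (1 : Matrix (Fin 3) (Fin 3) (w.1.adicCompletion L)).charpoly.coeff i) < 1} with hW'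
  have hW'c : IsClopen W' := isClopen_setOf_residuallyUnipotent L H' v w hw
  set ψ : (cmDatum L 3 H').Local v → ℂ := W'.indicator φ with hψdef
  have hψ : IsLocSmooth ψ := isLocSmooth_indicator_of_isClopen hφ hW'c
  have hψW : tsupport ψ ⊆ W' := by
    rw [tsupport, hW'c.isClosed.closure_subset_iff]
    exact Set.support_indicator_subset
  -- the vertex stabilisers covering `W′`
  have hc' : ∀ δ : W', ∃ g : GL (Fin 3) (w.1.adicCompletion L), P g ∧
      mapGL ((localNonsplitEquiv (IsCMField.complexConj L) H' (IsCMField.complexConj_ne_one L) w hw (δ : (cmDatum L 3 H').Local v) :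
          ↥(unitaryGroupOfForm (galAdicCompletionMap (L := L) (IsCMField.complexConj L) hw) (placeForm H' w.1))) :
        GL (Fin 3) (w.1.adicCompletion L)) (latt (g : Matrix (Fin 3) (Fin 3) (w.1.adicCompletion L))) = latt (g : Matrix (Fin 3) (Fin 3) (w.1.adicCompletion L)) :=
    fun δ => hcov δ.1 δ.2
  choose gsel hgP hgfix using hc'
  have hK' : ∀ δ : W', ∃ K : Subgroup ((cmDatum L 3 H').Local v),
      IsCompact (K : Set ((cmDatum L 3 H').Local v)) ∧ IsOpen (K : Set ((cmDatum L 3 H').Local v)) ∧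
      ∀ u : (cmDatum L 3 H').Local v, u ∈ K ↔
        mapGL ((localNonsplitEquiv (IsCMField.complexConj L) H' (IsCMField.complexConj_ne_one L) w hw u :
            ↥(unitaryGroupOfForm (galAdicCompletionMap (L := L) (IsCMField.complexConj L) hw) (placeForm H' w.1))) :
          GL (Fin 3) (w.1.adicCompletion L)) (latt (gsel δ : Matrix (Fin 3) (Fin 3) (w.1.adicCompletion L))) = latt (gsel δ : Matrix (Fin 3) (Fin 3) (w.1.adicCompletion L)) :=
    fun δ => exists_vertexStabilizer L v w hw H' (gsel δ)
  choose Ksel hKc hKo hKmem using hK'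
  -- `tsupport ψ` is covered by the open stabilisers
  have hcover : tsupport ψ ⊆ ⋃ δ : W', (Ksel δ : Set ((cmDatum L 3 H').Local v)) := by
    intro x hx
    have hxW : x ∈ W' := hψW hx
    exact Set.mem_iUnion.2 ⟨⟨x, hxW⟩, (hKmem ⟨x, hxW⟩ x).2 (hgfix ⟨x, hxW⟩)⟩
  -- cut `ψ` into pieces subordinate to the cover
  obtain ⟨n, V, hV, -, -, -, hpieces, hsum⟩ := exists_pieces_classOrbitalIntegral_eq_sum_local L H' v hH' hdet' hmG
    (fun δ : W' => (Ksel δ : Set ((cmDatum L 3 H').Local v))) (fun δ => hKo δ) hψ hcover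
  choose isel hVsub using fun j => (hV j).2.2.2
  -- average each piece over its stabiliser
  have havg : ∀ j : Fin n, ∃ (m : ℕ) (k : Fin m → (cmDatum L 3 H').Local v), 0 < m ∧ (∀ i, k i ∈ Ksel (isel j)) ∧
      IsLocallyConstant (fun x => (m : ℂ)⁻¹ * ∑ i, (V j).indicator ψ (k i * x * (k i)⁻¹)) ∧
      HasCompactSupport (fun x => (m : ℂ)⁻¹ * ∑ i, (V j).indicator ψ (k i * x * (k i)⁻¹)) ∧
      (∀ u ∈ Ksel (isel j), ∀ x, (m : ℂ)⁻¹ * ∑ i, (V j).indicator ψ (k i * (u * x * u⁻¹) * (k i)⁻¹) = (m : ℂ)⁻¹ * ∑ i, (V j).indicator ψ (k i * x * (k i)⁻¹)) ∧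
      (tsupport ((V j).indicator ψ) ⊆ (Ksel (isel j) : Set ((cmDatum L 3 H').Local v)) →
        tsupport (fun x => (m : ℂ)⁻¹ * ∑ i, (V j).indicator ψ (k i * x * (k i)⁻¹)) ⊆ (Ksel (isel j) : Set ((cmDatum L 3 H').Local v))) :=
    fun j => exists_conj_average_of_hasCompactSupport (hKo (isel j)) (hKc (isel j)) (hpieces j).1.1 (hpieces j).1.2
  choose m k hm hk hlc hcs hinv htsupp using havg
  -- the pieces
  refine ⟨n, fun j => Ksel (isel j), fun j x => (m j : ℂ)⁻¹ * ∑ i, (V j).indicator ψ (k j i * x * (k j i)⁻¹),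
    fun j => ⟨gsel (isel j), hgP (isel j), hKc (isel j), hKo (isel j), hKmem (isel j)⟩,
    fun j => ⟨hlc j, hcs j⟩, fun j => htsupp j ((hpieces j).2.trans (hVsub j)), fun j u hu x => hinv j u hu x, ?_⟩
  -- the neighbourhood of `1 ∈ H_v` and the class-by-class identity
  refine ⟨_, setOf_residuallyUnipotent_endoEmbLocal_mem_nhds_one L v w, fun γH hγV hγreg => ?_⟩
  have hclass : ∀ c : ConjClasses ((cmDatum L 3 H').Local v),
      T.Δ γH (Quotient.out c) * classOrbitalIntegral mG φ c =
        ∑ j, T.Δ γH (Quotient.out c) * classOrbitalIntegral mG (fun x => (m j : ℂ)⁻¹ * ∑ i, (V j).indicator ψ (k j i * x * (k j i)⁻¹)) c := by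
    intro c
    by_cases hΔ : T.Δ γH (Quotient.out c) = 0
    · simp only [hΔ, zero_mul, Finset.sum_const_zero]
    · have hR : IsLocalNormPair L H' v γH (Quotient.out c) := by
        by_contra hn; exact hΔ (T.eq_zero_of_not_rel _ _ hn)
      have hreg : IsRegularElt ((Quotient.out c).val : GL (Fin 3) (LocalRing L v)) := isRegularElt_of_isLocalNormPair L H' v hR hγreg
      have hcW : ∀ y : (cmDatum L 3 H').Local v, y * Quotient.out c * y⁻¹ ∈ W' :=
        fun y => residuallyUnipotent_conj_of_delta_ne_zero L H' v w hw T γH hγV c hΔ y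
      rw [← classOrbitalIntegral_indicator_of_forall_conj_mem L H' v mG c hcW φ, ← Finset.mul_sum]
      congr 1
      rw [hsum c hreg]
      exact Finset.sum_congr rfl fun j _ =>
        (classOrbitalIntegral_conjAverage_eq L H' v hH' hdet' hmG c hreg (hpieces j).1 (hm j) (k j)).symm
  rw [finsum_congr hclass]
  exact finsum_sum_comm _ _ fun j _ =>
    finite_support_delta_mul_classOrbitalIntegral_of_isLocSmooth L H' v hH' hdet' T mG _ ⟨hlc j, hcs j⟩ γH hγreg

/-- **«SPAN» (two vertex types, HYPOTHESIS-FREE)**: the pieces are supported in stabilisers of VERTEX lattices (`IsVertex`, either type) — the cover is ★ S-c FILE A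
`exists_isVertex_mapGL_localNonsplitEquiv_eq_of_charpoly` (residually unipotent ⇒ integral characteristic polynomial ⇒ a fixed vertex).  This is the statement of the
END-contract stub «SPAN» with `IsVertexStab K :≡ ∃ g, IsVertex σ_w ϖ H′_w (latt g) ∧ (K = the stabiliser of latt g)`. [cite: Rogawski1990, §4.9 Lemma 4.9.3 p. 56]
[cite: LanglandsShelstad1990Descent, §2.1] [cite: BruhatTits1972, §10] -/
theorem span_isVertex (hH' : (H'.map (cmConjRingHom L))ᵀ = H') (hdet' : H'.det ≠ 0)
    {ϖ : w.1.adicCompletion L} (hϖ : Valued.v ϖ = WithZero.exp (-1 : ℤ))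
    (T : LocalTransferFactor L H' v) {mG : OrbitalMeasureFamily ((cmDatum L 3 H').Local v)}
    (hmG : mG.IsAdmissibleOn fun γ' => IsRegularElt (γ'.val : GL (Fin 3) (LocalRing L v)))
    (φ : (cmDatum L 3 H').Local v → ℂ) (hφ : IsLocSmooth φ) :
    ∃ (n : ℕ) (K : Fin n → Subgroup ((cmDatum L 3 H').Local v)) (g : Fin n → (cmDatum L 3 H').Local v → ℂ),
      (∀ k, ∃ gk : GL (Fin 3) (w.1.adicCompletion L),
        IsVertex (galAdicCompletionMap (L := L) (IsCMField.complexConj L) hw) ϖ (placeForm H' w.1) (latt (gk : Matrix (Fin 3) (Fin 3) (w.1.adicCompletion L))) ∧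
        IsCompact (K k : Set ((cmDatum L 3 H').Local v)) ∧ IsOpen (K k : Set ((cmDatum L 3 H').Local v)) ∧
        ∀ u : (cmDatum L 3 H').Local v, u ∈ K k ↔
          mapGL ((localNonsplitEquiv (IsCMField.complexConj L) H' (IsCMField.complexConj_ne_one L) w hw u :
              ↥(unitaryGroupOfForm (galAdicCompletionMap (L := L) (IsCMField.complexConj L) hw) (placeForm H' w.1))) :
            GL (Fin 3) (w.1.adicCompletion L)) (latt (gk : Matrix (Fin 3) (Fin 3) (w.1.adicCompletion L))) = latt (gk : Matrix (Fin 3) (Fin 3) (w.1.adicCompletion L))) ∧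
      (∀ k, IsLocSmooth (g k)) ∧ (∀ k, tsupport (g k) ⊆ (K k : Set ((cmDatum L 3 H').Local v))) ∧
      (∀ k, ∀ u ∈ K k, ∀ x, g k (u * x * u⁻¹) = g k x) ∧
      ∃ V ∈ 𝓝 (1 : (cmDatum L 2 (Matrix.of fun i j : Fin 2 => if i.val + j.val + 1 = 2 then (1 : L) else 0)).Local v ×
          (cmDatum L 1 (Matrix.of fun i j : Fin 1 => if i.val + j.val + 1 = 1 then (1 : L) else 0)).Local v),
        ∀ γH ∈ V, IsLocalGRegular L v γH →
          (∑ᶠ c : ConjClasses ((cmDatum L 3 H').Local v), T.Δ γH (Quotient.out c) * classOrbitalIntegral mG φ c) =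
            ∑ k, ∑ᶠ c : ConjClasses ((cmDatum L 3 H').Local v), T.Δ γH (Quotient.out c) * classOrbitalIntegral mG (g k) c :=
  span_of_cover L H' v w hw hH' hdet'
    (P := fun g => IsVertex (galAdicCompletionMap (L := L) (IsCMField.complexConj L) hw) ϖ (placeForm H' w.1) (latt (g : Matrix (Fin 3) (Fin 3) (w.1.adicCompletion L))))
    (fun δ hδ => exists_isVertex_mapGL_localNonsplitEquiv_eq_of_charpoly L v w hw H' hH' hdet' hϖ δ
      (v_charpoly_coeff_le_one_of_residuallyUnipotent _ hδ))
    T hmG φ hφ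

end Span

end Literature.NumberTheory.Rogawski1990

end
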